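import Literature.NumberTheory.EllipticCurves.Gamma0CocycleDegeneracyMaps
import Mathlib.FieldTheory.IsAlgClosed.AlgebraicClosure
import HarnessLib
import HarnessLib.Audit.Tags

/-!
# Candidate E-es-25 (official es g10 text): the RELATIVE IHARA statement `RelativeIharaShiftVanishingBar p t n`
# at a prime power `t^n`, `t` allowed to divide the level — cell `bsd-f2-manin` (D-0131 (3) frontier: the Manin
# constant at additive primes). `@[conjecture]` leaf (NOTHING asserted; one definition; no edges here).

HONEST FRAMING. LENS = Euler systems / explicit reciprocity (planner `bsd-f2-manin-es` g9–g10; HOME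
`run/shared/lean/pub/bsd-f2-manin/MEMO-es.md` §21 «the generation conjectures are relative-Ihara statements at
primes dividing the level», §22 «the relative Ihara lemma E-es-25 is a theorem modulo print — cusp-symbol descent»;
source of the Prop: HOME/es/Sketch-es-g10.lean sha16 a9b3fba2534a6c84 §4 `EsG10.RelativeIharaShiftVanishingBar`,
farm rc 0 · 0 sorries · 0 warnings, itself = the typer's g4 cocycle text `EsG9Typed.RelativeIharaShiftVanishing`
(HOME/typer/T-es-12-EsG9-RelativeIhara-typed.lean 6b864b3eec149fa6) with ONE hypothesis changed by es (§22.6(b)):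
the non-Eisenstein side condition is read with TWO characters over an algebraic closure,
`¬ IsEisensteinEigensystem 2 (algebraMap K K̄ ∘ λ)`, because boundary classes of `Γ₀(L)` with a non-quadratic
cusp character `χ` carry systems `χ(ℓ) + ℓχ⁻¹(ℓ)` which the typer's narrow/over-`K` text did not exclude).
The body below is that text VERBATIM after the guard prefix `p.Prime → t.Prime → 1 ≤ n →` added by the typer
(vacuity discipline, cell refuter-1 §R9.4/§R31: the unguarded schema is false at `t = 1` or `n = 0`, where the
shift hypothesis is empty and every non-Eisenstein eigen-cocycle would have to vanish; the cell instantiates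
only `(3,3,1)`, `(2,2,3)`, `(2,q,1)`, and es's own prose reads «for primes `p`, `t`, `n ≥ 1`»). Vocabulary (all
landed, `Literature/NumberTheory/EllipticCurves/Gamma0CocycleDegeneracyMaps.lean`, typer p593252…p594975):
`HidaCohomology.cocycles 0 L K = Hom(Γ₀(L), K)`, `HidaCohomology.IsHeckeGenEigenvector S λ u` (generalised
`T_ℓ`-eigenvector for all primes `ℓ ∉ S`), `HidaCohomology.degeneracyPullback 0 L (L·d) d K _ u = π_d^* u =
u ∘ (γ ↦ diag(d,1) γ diag(d,1)⁻¹)` (`Gamma0.degeneracyConj`), `IsEisensteinEigensystem 2 λ` (`λ(ℓ) = ψ(ℓ) +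
ℓ φ(ℓ)` off a finite set, Diamond–Shurman Prop. 5.2.3).

THE ROW. **E-es-25 `RelativeIharaShiftVanishingBar p t n`**: for primes `p`, `t` (`t = p` and `t ∣ L` allowed),
`n ≥ 1`, a field `K` of characteristic `p`, a level `L ≥ 1`, a finite `S ⊇` primes of `ptL`, a system `λ` off `S`
that is NOT Eisenstein over `K̄`, every `u ∈ Hom(Γ₀(L), K)` in the `λ`-generalised eigenspace of the `T_ℓ`
(`ℓ ∉ S`) with `π_{t^n}^* u = π_1^* u` on `Γ₀(t^n L)` is `0`. WHY THE CELL WANTS IT (MEMO-es §21.3, §22.8; line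
prover p3 `Summits/…/Theorems/ManinLocalTwoThreeGenerationOfRelativeIhara.lean`
`shiftClassGenerationThree_of_relativeIhara (hRI) (hNE)`, p594985, and `…RelativeIharaTwo.lean`): instantiated at
`(3,3,1)` it turns the C3 generation stub E-es-19 `ShiftClassGenerationThree` (crux `ManinPrimeToThreeAtNine`,
stmt-BirchSwinnertonDyer-22968; all 214 840 `W[3]`-irreducible optimal classes with `9 ∣ N`) into a consequence of
this statement and of the curve-side fact «`W[p]` irreducible, `p` odd ⟹ `ℓ ↦ a_ℓ(W) mod p` not Eisenstein over
`𝔽̄_p`» (Literature named fact `not_isEisensteinEigensystem_of_hasIrreducibleModPGaloisRep`, typer p596515,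
Darmon–Diamond–Taylor 1995 Prop. 2.6(b)/Lemma 4.12 reading); at `(2,2,3)`, `(2,q,1)` it does the same for the
`S₃`-image part (634 157 of 897 670 classes) of the C2 stub E-es-22 (stmt-BirchSwinnertonDyer-22967), given an Ihara
lemma for `Γ₀` in residue characteristic `2` (cell fact request F-es-28, NOT landed: Darmon–Diamond–Taylor §§4.2–4.5
stand under «`ℓ` odd», p. 111; the characteristic-free route Ribet 1984 Thm. 4.1 + Ling–Oesterlé 1991 is wanted,
acq-13666/13667/13668). STATUS CLAIMED BY es (§22, NOT refereed at filing): THEOREM-candidate for `p` odd — a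
`P¹(ℚ)`-symbol DESCENT (lift `u` to a `Γ₀(L)`-invariant cusp symbol `Φ`, E-es-29a; `Φ∘A_t^n − Φ` is a `λ`-eigen
BOUNDARY symbol hence `0`, E-es-30 «the cusp module of `Γ₀(L)` is Eisenstein»; DESCENT and POWER group lemmas
`⟨Γ₀(L), A_t^{±n}⟩ ⊇ Γ₀(L') ∪ A_t⁻¹Γ₀(L')A_t`, `L'` the `t`-free part, E-es-29, pure `2×2` arithmetic; bottom =
the classical Ihara lemma at level `L'q` in kernel-pair form, PROVED in the sketch from the tree fact
`ribet1984_iharaLemma`; end by normal closure) reduces it to print; none of E-es-29a/29/30 is kernel-checked.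

NOT IN PRINT as a statement (cell refuter-2 placement pending, R-es-22(b); es's own presearch §21.5/§22.9, both
corpora): the printed Ihara lemmas are the classical `t ∤ L`, `n = 1` case for `Γ₀` (Ihara 1975; Ribet 1984 Thm. 4.1,
tree fact `ribet1984_iharaLemma`, Darmon–Diamond–Taylor 1995 Lemma 4.28 (a) p. 135), the `Γ₁`-type one-power-step
pairs form (Wiles 1995 Lemma 2.5 [corpus: paper:url-ccda702969a9 pp. 493–494] = Darmon–Diamond–Taylor Lemma 4.28 (b),
«`ℓ` odd», with Remark 4.29: Khare 1995 §2 proves it by modular symbols — acq-09663 open, the nearest prior art of the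
descent), Diamond–Taylor 1994 (multi-copy, `t ∤ L`), and the `Γ₀`-translation «the cokernel is supported only at
Eisenstein maximal ideals» (Diamond–Ribet 1997 p. 371, Lemma 4.6 for `m_p = 1`); a single `Γ₀`-statement with
ARBITRARY `t^k ∥ L`, shift `t^n` (`n ≥ 2` included), `p = t` and `p = 2` uniform, in cocycle currency, is not found —
es grade expectation «variant / new-combination at best; the value is the application».

BC5 WITNESS (cell census of record; es MEMO-es §21.4/§21.10/§22.9): HOME/es/E18B-SHIFT3-levels-v1.tsv
1a40491e51294edf · all 76 levels `N = 9k`, `27 ≤ N ≤ 702`, instance `(3,3,1)` on `H¹(X₀(N), 𝔽₃)` · 76/76 six-fold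
equality (dim of the Hecke-stable shift-annihilator = #Eisenstein diamond lines = dia_pred = dia_realised), i.e. NO
non-Eisenstein system survives in the shift-invariant part · violations 0; HOME/es/E21-SHIFTP 1e9663aa6aefd11d ·
68/68 at `(P,P,1)`, `P ∈ {3,5,7}` · violations 0; `p = 2` shadow HOME/es/E19B-SHIFT2-levels-v1.tsv 055a83920c785e77
196/196 levels `4k ≤ 800`. Beyond-print rows: n/a (a statement about `H¹(Γ₀(L), K)`, not about `c_E`; its `c_E`
consequences are behind the other stubs of the C2/C3 skeletons). Cheapest falsifiers NOT yet run (D-es-8): mixed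
`(p,t)` (`p = 3, t = 2` at `36 ∣ N`), `n ≥ 2` (`(2,2,3)` on `H¹(X₀(4k),𝔽₂)` directly), and the boundary-class test
at `N ∈ {196, 392}` deciding the typer's superseded narrow text.
REFUTER VERDICTS AT FILING (2026-08-28): REF1 R-es-21 (g9 text) and R-es-22 (a) (this text, A1–A6/BC7 + referee of
MEMO-es §22.4–22.5) PENDING; REF2 R-es-22 (b) PENDING. Filed before the audit at the line provers' request (p3
2026-08-28T01:48:54Z «file `RelativeIharaShiftVanishing` … as a named leaf so hRI is BY NAME»; es 02:00:08Z «if you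
file a named leaf for p3's hRI, file THIS one»); a refuter-repaired text, if any, lands under a NEW name (suffix `R`)
per the tree's append-only rule, with bridging lemmas in a sibling file.
-/

noncomputable section

open scoped MatrixGroups ModularForm

open CongruenceSubgroup
  Literature.NumberTheory.EllipticCurves Literature.NumberTheory.EllipticCurves.ModularForms
  Literature.NumberTheory.EllipticCurves.ModularForms.HidaCohomology

namespace Summit.BirchSwinnertonDyer.Rank1Residual.ManinAdditive

/-- **Candidate E-es-25 `RelativeIharaShiftVanishingBar p t n` (cell bsd-f2-manin, es g10 OFFICIAL text; nothing
asserted).** For primes `p`, `t` (`t = p` allowed, `t ∣ L` allowed) and `n ≥ 1`: for every field `K` of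
characteristic `p`, every level `L ≥ 1`, every finite set `S` containing the primes of `p·t·L`, every system
`λ : ℕ → K` whose image in `K̄ = AlgebraicClosure K` is NOT a weight-`2` Eisenstein system `ψ(ℓ) + ℓ φ(ℓ)` (two
Dirichlet characters, off a finite set), and every `u ∈ Hom(Γ₀(L), K) = cocycles 0 L K` that is a generalised
`T_ℓ`-eigenvector with eigenvalues `λ(ℓ)` for all primes `ℓ ∉ S`: if `π_{t^n}^* u = π_1^* u` as cochains on
`Γ₀(t^n L)` (`u(diag(t^n,1) γ diag(t^n,1)⁻¹) = u(γ)` for all `γ ∈ Γ₀(t^n L)`), then `u = 0`. VERBATIM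
HOME/es/Sketch-es-g10.lean a9b3fba2534a6c84 §4 after the typer's guard prefix `p.Prime → t.Prime → 1 ≤ n →`.
Classical shape (`t ∤ L`, `n = 1`, homology of `X₀`): Ihara's lemma, Ribet 1984 Thm. 4.1 / tree fact
`ribet1984_iharaLemma`; the relative form is NOT in print (cell memo MEMO-es §22: theorem-candidate for `p` odd by
symbol descent, unrefereed at filing; refuter verdicts pending — see the module docstring).
[cite: Ribet1984ICM, Thm. 4.1 (shape only: the classical `t ∤ L`, `n = 1` Ihara lemma; the relative `t^n ∣ L` cocycle form is NOT in print — cell memo MEMO-es §22)] -/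
@[conjecture]
def RelativeIharaShiftVanishingBar (p t n : ℕ) : Prop :=
  p.Prime → t.Prime → 1 ≤ n →
  ∀ (K : Type) [Field K] [CharP K p] (L : ℕ) [NeZero L] [NeZero t] (S : Finset ℕ)
    (lam : ℕ → K) (u : cocycles 0 L K),
    (∀ q : ℕ, q.Prime → q ∣ p * t * L → q ∈ S) →
    IsHeckeGenEigenvector S lam u →
    ¬ IsEisensteinEigensystem 2 (fun ℓ => algebraMap K (AlgebraicClosure K) (lam ℓ)) →
    degeneracyPullback 0 L (L * t ^ n) (t ^ n) K dvd_rfl (u : Gamma0 L → Fin 1 → K) =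
      degeneracyPullback 0 L (L * t ^ n) 1 K (by simp) (u : Gamma0 L → Fin 1 → K) →
    u = 0

end Summit.BirchSwinnertonDyer.Rank1Residual.ManinAdditive

end
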